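import Literature.NumberTheory.GaloisRepresentations.ArtinConductorLocalLAdicProofs
import HarnessLib

/-!
# The local Artin conductor with finite wild image on a Hausdorff module, reduced to the
Hasse–Arf theorem (trunk GalRep, item C10; provefact `natCast_localArtinConductor`, third file)

Theorems only.  `ArtinConductor.lean` states the integrality of the local Artin conductor
`a(ρ) = codim M^{I_F} + ∫₀^∞ codim M^{I_F^u} du` as the named fact
`GaloisRep.natCast_localArtinConductor` [Katz1988, Prop. 1.9], which is **mis-stated**
(faithfulness notes of `ArtinConductor.lean` and `ArtinConductorLocalProofs.lean`): the topologies
of `A` and `M` are arbitrary there, so for the indiscrete topology on `M` every abstract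
homomorphism `Γ_F → GL(M)` with finite image of `⋃_{u>0} I_F^u` qualifies, whereas Katz's Prop. 1.9
(held copy, Ch. 1 pp. 18–19) is about a *continuous* action with coefficients a complete noetherian
local ring with finite residue field, proved through "the representation of `I` factors through a
finite quotient", and 1.0 has `P` = "the closure of `⋃_{r>0} I^{(r)}`".  Two faithful forms are in
`ArtinConductor.lean` (`…_of_hasOpenInertiaKerAt`, `…_lAdic`) and are reduced to the Hasse–Arf
theorem in `ArtinConductorLocalProofs` and `ArtinConductorLocalLAdicProofs`.  This file records the
third one, the closest to the def: **the provefact statement with the single extra hypothesis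
`[T2Space M]`** — for a finite-dimensional `ρ : Γ_F → GL(M)` over a field `A` with
`(q_F : A) ≠ 0`, any topology on `A`, `M` Hausdorff, `ρ(⋃_{u>0} I_F^u)` finite:
`(localArtinConductor ρ : ℝ) = codim M^{I_F} + sw(ρ)`.  On a Hausdorff module the kernel of `ρ` is
closed, so finite wild image is exactly Katz's standing hypothesis "the action of `P` factors
through a finite discrete quotient" (1.1, 1.8: `HasFiniteWildImageAt.exists_normal_forall_apply_eq_one`
gives a finite normal — in characteristic `0` Galois — layer `E` with `ρ` trivial on
`Gal(F̄/E) ∩ \overline{⋃ I_F^u}`), while the inertia group may still act through an infinite image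
(Tate modules with multiplicative reduction); the integrality is then the Clifford transfer of
`ArtinConductorLocalLAdicProofs` (`GaloisRep.exists_natCast_eq_localArtinConductorReal_of_wild`,
Artin's theorem over `Ā` at the layer `E`) fed with Artin's theorem for the inertia group of the
layer from `ArtinConductorLocalProofs` (`exists_natCast_eq_artinExponent_inertia_local`: Brauer, the
different, the degree-one integrality `hHA` = Herbrand + Hasse–Arf, and, for coefficient fields of
positive characteristic only, Artin's theorem over finite fields `hfin`).

* `Literature.NumberTheory.GaloisRepresentations.GaloisRep.exists_natCast_eq_localArtinConductorReal_of_wild_of_arith`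
  — `a(ρ) ∈ ℕ` for `ρ` trivial on `Gal(F̄/E) ∩ I_F^u` (`u > 0`, any topologies), from `hHA` at the
  layer `E` and `hfin`;
* `Literature.NumberTheory.GaloisRepresentations.GaloisRep.natCast_localArtinConductor_of_t2Space_of_arith`
  — the Hausdorff form from `hHA` (all layers) and `hfin`;
* `Literature.NumberTheory.GaloisRepresentations.GaloisRep.natCast_localArtinConductor_of_t2Space_of_hasseArf`
  — the Hausdorff form from the Hasse–Arf theorem (`hasseArf`) and `hfin`;
* `Literature.NumberTheory.GaloisRepresentations.GaloisRep.natCast_localArtinConductor_of_t2Space_of_hasseArf_charZero`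
  — coefficient fields of characteristic `0` (`ℂ`, `ℚ̄_ℓ`, `E_λ`, any topology on `A`): the
  Hausdorff form from the Hasse–Arf theorem **alone**.

Scope: `F` of characteristic `0`, as for `GaloisRep.exists_natCast_eq_localArtinConductorReal_of_wild`
(the lift of a generator of `G_0/G_1` to `I_F` and the Galois property of the Krull layer).  No
named fact is introduced.

## References

* N. M. Katz, *Gauss Sums, Kloosterman Sums, and Monodromy Groups*, Ann. of Math. Studies 116,
  Princeton 1988, Ch. 1: 1.0, 1.1, 1.8, Prop. 1.9 and its proof, Remark 1.10 (held copy
  `book:katz1988-gauss-sums-kloosterman-sums-monodromy-groups`, pp. 15–19). [Katz1988]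
* J.-P. Serre, *Local Fields*, GTM 67 (1979), Ch. IV §3 Theorem (Hasse–Arf); Ch. VI §2 Thm 1',
  Cor. 1'. [SerreLocalFields1979]
-/

noncomputable section

open scoped Valued
open Field IsDedekindDomain MeasureTheory Module ValuativeRel
open Literature.NumberTheory.GaloisRepresentations.IsNonarchimedeanLocalField

namespace Literature.NumberTheory.GaloisRepresentations

namespace GaloisRep

universe u v w

variable {F : Type u} [Field F] [ValuativeRel F] [TopologicalSpace F] [IsNonarchimedeanLocalField F]

/-- **`a(ρ) ∈ ℕ` with open wild kernel, from the arithmetic leaves** (local field of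
characteristic `0`, coefficient field `A` arbitrary with `(q_F : A) ≠ 0`): the Clifford transfer
`exists_natCast_eq_localArtinConductorReal_of_wild` (`ArtinConductorLocalLAdicProofs`) with Artin's
theorem for `G_0 = I(𝔓 ∩ E)` over `Ā` supplied by `exists_natCast_eq_artinExponent_inertia_local`
(`ArtinConductorLocalProofs`) from the degree-one integrality `hHA` (Serre VI §2 Cor. to Prop. 5,
Herbrand + Hasse–Arf) at the layer `E` and, when `char A = ℓ > 0`, the finite-field case `hfin`
(Katz 1.9 with `A = 𝔽_λ`; over `Ā` the finite coefficient fields `κ` live in the universe of `A`).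
Ref: Katz (1988), Ch. 1, 1.8 and Prop. 1.9; Serre, *Local Fields* (1979), Ch. VI §2 Thm 1'.
[cite: Katz1988, Ch. 1, 1.8 and Prop. 1.9] [cite: SerreLocalFields1979, Ch. VI §2, Thm 1' (proof)] -/
theorem exists_natCast_eq_localArtinConductorReal_of_wild_of_arith [CharZero F]
    {A : Type v} [Field A] [TopologicalSpace A] {M : Type w} [AddCommGroup M] [Module A M]
    [TopologicalSpace M] [FiniteDimensional A M]
    (E : IntermediateField F (AlgebraicClosure F)) [FiniteDimensional F E] [IsGalois F E]
    (hHA : card_inf_inertia_dvd_finsum_card_inf_ramificationSubgroup 𝒪[F] (K := F) (L := E))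
    (hfin : ∀ (κ : Type v) [Field κ] [Finite κ] (n : ℕ)
      (τ' : Representation κ (((absMaximalIdeal F).comap
        (E.integralClosureToAbsIntegers 𝒪[F])).inertia (E ≃ₐ[F] E)) (Fin n → κ)),
      ((ringChar 𝓀[F] : ℕ) : κ) ≠ 0 →
        ∃ m : ℕ, (m : ℝ) = artinExponent ((absMaximalIdeal F).comap
          (E.integralClosureToAbsIntegers 𝒪[F])) (E ≃ₐ[F] E)
          (((absMaximalIdeal F).comap (E.integralClosureToAbsIntegers 𝒪[F])).inertia
            (E ≃ₐ[F] E)).subtype τ')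
    (ρ : GaloisRep F A M) (hchar : (residueFieldCard F : A) ≠ 0)
    (hW : ∀ u : ℝ, 0 < u → ∀ σ ∈ absUpperInertia F u, absRestrictNormalHom E σ = 1 → ρ σ = 1) :
    ∃ n : ℕ, (n : ℝ) = ρ.localArtinConductorReal := by
  have hchar' : (residueFieldCard F : AlgebraicClosure A) ≠ 0 := by
    intro h
    apply hchar
    apply (algebraMap A (AlgebraicClosure A)).injective
    rw [map_natCast, map_zero, h]
  refine exists_natCast_eq_localArtinConductorReal_of_wild E (fun V _ _ _ Θ => ?_) ρ hchar hW
  exact exists_natCast_eq_artinExponent_inertia_local (A := AlgebraicClosure A) E hHA Θ hchar'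
    fun _ _ _ κ _ _ n τ' hp => hfin κ n τ' hp

/-- **The provefact statement `natCast_localArtinConductor` on a Hausdorff module, from the
degree-one integrality and the finite-field case.**  For `F` of characteristic `0`, a
finite-dimensional `ρ : Γ_F → GL(M)` over a field `A` with `(q_F : A) ≠ 0` (any topology on `A`)
on a **Hausdorff** `A`-module `M`, with finite wild image (`HasFiniteWildImageAt`:
`ρ(⋃_{u>0} I_F^u)` finite), `(localArtinConductor ρ : ℝ) = codim M^{I_F} + sw(ρ)` — the statement of
the mis-stated def with the single extra hypothesis `[T2Space M]`, which turns "finite wild image"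
into Katz's "the action of `P` factors through a finite discrete quotient"
(`HasFiniteWildImageAt.exists_normal_forall_apply_eq_one`: `ρ` is trivial on
`Gal(F̄/E) ∩ \overline{⋃ I_F^u}` for a finite normal, hence Galois, `E`), after which
`exists_natCast_eq_localArtinConductorReal_of_wild_of_arith` applies and `⌊n⌋₊ = n`.  Hypotheses:
`hHA`, the named fact `card_inf_inertia_dvd_finsum_card_inf_ramificationSubgroup 𝒪[F]` (Serre VI §2
Cor. to Prop. 5) for the finite layers of `F̄/F`; `hfin`, Artin's theorem over finite coefficient
fields for their inertia groups (Katz 1.9 with `A = 𝔽_λ`; used only when `char A > 0`).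
Ref: Katz, *Gauss sums, Kloosterman sums, and monodromy groups* (1988), Ch. 1, 1.8, Prop. 1.9 and
Remark 1.10; Serre, *Local Fields* (1979), Ch. VI §2 Thm 1'.
[cite: Katz1988, Ch. 1, Prop. 1.9 (proof) and Remark 1.10] -/
theorem natCast_localArtinConductor_of_t2Space_of_arith [CharZero F]
    (hHA : ∀ E : IntermediateField F (AlgebraicClosure F),
      card_inf_inertia_dvd_finsum_card_inf_ramificationSubgroup 𝒪[F] (K := F) (L := E))
    (hfin : ∀ (E : IntermediateField F (AlgebraicClosure F)) [FiniteDimensional F E] [IsGalois F E]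
      (κ : Type v) [Field κ] [Finite κ] (n : ℕ)
      (τ' : Representation κ (((absMaximalIdeal F).comap
        (E.integralClosureToAbsIntegers 𝒪[F])).inertia (E ≃ₐ[F] E)) (Fin n → κ)),
      ((ringChar 𝓀[F] : ℕ) : κ) ≠ 0 →
        ∃ m : ℕ, (m : ℝ) = artinExponent ((absMaximalIdeal F).comap
          (E.integralClosureToAbsIntegers 𝒪[F])) (E ≃ₐ[F] E)
          (((absMaximalIdeal F).comap (E.integralClosureToAbsIntegers 𝒪[F])).inertia
            (E ≃ₐ[F] E)).subtype τ')
    {A : Type v} [Field A] [TopologicalSpace A] {M : Type w} [AddCommGroup M] [Module A M]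
    [TopologicalSpace M] [T2Space M] [FiniteDimensional A M] (ρ : GaloisRep F A M)
    (hchar : (residueFieldCard F : A) ≠ 0) (hρ : ρ.HasFiniteWildImageAt 𝒪[F] (absMaximalIdeal F)) :
    (ρ.localArtinConductor : ℝ) = ρ.localArtinConductorReal := by
  obtain ⟨E, hEfd, hEn, hE⟩ := hρ.exists_normal_forall_apply_eq_one
  haveI := hEfd
  haveI := hEn
  haveI : Algebra.IsSeparable F E := Algebra.IsSeparable.of_integral F E
  haveI : IsGalois F E := {}
  have hW : ∀ u : ℝ, 0 < u → ∀ σ ∈ absUpperInertia F u, absRestrictNormalHom E σ = 1 → ρ σ = 1 := by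
    intro u hu σ hσ h1
    refine hE σ (subset_closure ⟨u, hu, hσ⟩) ?_
    rw [← IntermediateField.restrictNormalHom_ker, MonoidHom.mem_ker]
    exact h1
  obtain ⟨n, hn⟩ := exists_natCast_eq_localArtinConductorReal_of_wild_of_arith E (hHA E)
    (fun κ _ _ n τ' hp => hfin E κ n τ' hp) ρ hchar hW
  rw [localArtinConductor, ← hn, Nat.floor_natCast]

/-- **The Hausdorff form from the Hasse–Arf theorem and the finite-field case**: as
`natCast_localArtinConductor_of_t2Space_of_arith`, with the degree-one integrality supplied by
`card_inf_inertia_dvd_finsum_card_inf_ramificationSubgroup_of_hasseArf`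
(`ArtinRepresentationHasseArfProofs`: Serre's Cor. to Prop. VI.5 from Herbrand's theorem and the
Hasse–Arf theorem), so that the remaining inputs are exactly the two leaves of the printed theory
still stated as named facts in the tree: `hasseArf` (for the finite Galois extensions of Dedekind
fraction fields in the universe of `F`) and — for coefficient fields of positive characteristic
only — Artin's theorem over finite fields.
[cite: Katz1988, Ch. 1, Prop. 1.9 (proof) and Remark 1.10]
[cite: SerreLocalFields1979, Ch. IV §3, Theorem (Hasse–Arf)] -/
theorem natCast_localArtinConductor_of_t2Space_of_hasseArf [CharZero F]
    (hHA : ∀ (R' K' L' : Type u) [CommRing R'] [Field K'] [Field L'] [Algebra R' K']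
      [Algebra R' L'] [Algebra K' L'] [IsScalarTower R' K' L'], hasseArf R' (K := K') (L := L'))
    (hfin : ∀ (E : IntermediateField F (AlgebraicClosure F)) [FiniteDimensional F E] [IsGalois F E]
      (κ : Type v) [Field κ] [Finite κ] (n : ℕ)
      (τ' : Representation κ (((absMaximalIdeal F).comap
        (E.integralClosureToAbsIntegers 𝒪[F])).inertia (E ≃ₐ[F] E)) (Fin n → κ)),
      ((ringChar 𝓀[F] : ℕ) : κ) ≠ 0 →
        ∃ m : ℕ, (m : ℝ) = artinExponent ((absMaximalIdeal F).comap
          (E.integralClosureToAbsIntegers 𝒪[F])) (E ≃ₐ[F] E)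
          (((absMaximalIdeal F).comap (E.integralClosureToAbsIntegers 𝒪[F])).inertia
            (E ≃ₐ[F] E)).subtype τ')
    {A : Type v} [Field A] [TopologicalSpace A] {M : Type w} [AddCommGroup M] [Module A M]
    [TopologicalSpace M] [T2Space M] [FiniteDimensional A M] (ρ : GaloisRep F A M)
    (hchar : (residueFieldCard F : A) ≠ 0) (hρ : ρ.HasFiniteWildImageAt 𝒪[F] (absMaximalIdeal F)) :
    (ρ.localArtinConductor : ℝ) = ρ.localArtinConductorReal :=
  natCast_localArtinConductor_of_t2Space_of_arith
    (fun _ => card_inf_inertia_dvd_finsum_card_inf_ramificationSubgroup_of_hasseArf hHA) hfin ρ hchar hρ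

/-- **Coefficient fields of characteristic `0`: the Hausdorff form from the Hasse–Arf theorem
alone** (`A = ℂ`, `ℚ̄_ℓ`, `E_λ`, any topology on `A`; the finite-field input is vacuous and
`(q_F : A) ≠ 0` is automatic): Artin's theorem over `Ā` at the Galois layer is
`exists_natCast_eq_artinExponent_inertia_local_charZero` fed with
`card_inf_inertia_dvd_finsum_card_inf_ramificationSubgroup_of_hasseArf hHA`.  This generalises
`natCast_localArtinConductor_lAdic_of_hasseArf_charZero` (`ArtinConductorLocalLAdicProofs`) from
`λ`-adic module topologies to any Hausdorff module with finite wild image.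
[cite: SerreLocalFields1979, Ch. VI §2, Thm 1' (proof)] [cite: Katz1988, Ch. 1, Prop. 1.9 (proof) and Remark 1.10] -/
theorem natCast_localArtinConductor_of_t2Space_of_hasseArf_charZero [CharZero F]
    (hHA : ∀ (R' K' L' : Type u) [CommRing R'] [Field K'] [Field L'] [Algebra R' K']
      [Algebra R' L'] [Algebra K' L'] [IsScalarTower R' K' L'], hasseArf R' (K := K') (L := L'))
    {A : Type v} [Field A] [CharZero A] [TopologicalSpace A] {M : Type w} [AddCommGroup M]
    [Module A M] [TopologicalSpace M] [T2Space M] [FiniteDimensional A M] (ρ : GaloisRep F A M)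
    (hρ : ρ.HasFiniteWildImageAt 𝒪[F] (absMaximalIdeal F)) :
    (ρ.localArtinConductor : ℝ) = ρ.localArtinConductorReal := by
  obtain ⟨E, hEfd, hEn, hE⟩ := hρ.exists_normal_forall_apply_eq_one
  haveI := hEfd
  haveI := hEn
  haveI : Algebra.IsSeparable F E := Algebra.IsSeparable.of_integral F E
  haveI : IsGalois F E := {}
  haveI : CharZero (AlgebraicClosure A) :=
    charZero_of_injective_algebraMap (algebraMap A (AlgebraicClosure A)).injective
  have hW : ∀ u : ℝ, 0 < u → ∀ σ ∈ absUpperInertia F u, absRestrictNormalHom E σ = 1 → ρ σ = 1 := by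
    intro u hu σ hσ h1
    refine hE σ (subset_closure ⟨u, hu, hσ⟩) ?_
    rw [← IntermediateField.restrictNormalHom_ker, MonoidHom.mem_ker]
    exact h1
  have hchar : (residueFieldCard F : A) ≠ 0 := Nat.cast_ne_zero.mpr (residueFieldCard_ne_zero F)
  obtain ⟨n, hn⟩ := exists_natCast_eq_localArtinConductorReal_of_wild E
    (fun V _ _ _ Θ => exists_natCast_eq_artinExponent_inertia_local_charZero
      (A := AlgebraicClosure A) E
      (card_inf_inertia_dvd_finsum_card_inf_ramificationSubgroup_of_hasseArf hHA) Θ) ρ hchar hW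
  rw [localArtinConductor, ← hn, Nat.floor_natCast]

end GaloisRep

end Literature.NumberTheory.GaloisRepresentations
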